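import Summits.QuantumFields.BalabanUV.Beta.FP.ChartConjugationBounded
import Summits.QuantumFields.BalabanUV.Beta.FP.SliceGaugeLaw
import Summits.QuantumFields.BalabanUV.Beta.DiagonalContactLoc

/-!
# `BalabanUV.Beta.FP.SliceContactChart` — road «FP», binder row D1, sub-row **H2-ASM-5a (Kcov)**, module R7: **THE SLICE'S REFLECTION CONTACT IS A CHART
# CONTACT** `sliceCt = conjV ddKer (diagK ctGen)` (an2's product-chart generator, the slice's own `d d*` form), **THE FOUR RELATIVE RULES HOLD AT THE PERFECT
# LEG** `(Pker, MF, idF)` by (P-INV), and hence **R6's CONSISTENCY IDENTITY HOLDS AT THE PERFECT LEG FOR EVERY DIAGONAL GENERATOR FAMILY** — the fifth conjunct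
# of the (Kcov) socket costs nothing beyond localisation and a tadpole-null remainder

HONEST DEPENDENCY (page 1, mandatory): continuum YM on T⁴ ⇐ BetaPertH ∧ nine spine estimates (0/9 proved); BetaPertH ⇐ (D1) ∧ (D4) ∧ CAP+tail;
G-an2-4 gates asym, D1 and NE2/3/4.  HONEST FRAMING (cell contract, verbatim): «discharging `BetaPertH` makes Bałaban's UV stability UNCONDITIONAL —
a real constructive-QFT result; it is NOT the continuum limit and NOT the Clay problem.»  THIS MODULE DISCHARGES NOTHING of the wall: finite indicator algebra over
EXPLICIT tree objects (`SliceVertexReflection.sliceCt` p251422, gan24-leaf-02-g41's `SliceGaugeLaw.ddKer`, an2's `BorderedHessian.diagK ∕ ctGen`, `PerfectPolarization.Pker`,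
`PerfectPropagatorInverse.MF ∕ idF`) and tree theorems BY NAME ((P-INV) `comp_Pker_MF ∕ comp_MF_Pker`, `decays_MF`, `bdd_Pker`, `idF_eq_idM`, `conjV_diagK_apply`,
`biLoc_diagK_ctGen`, R6 `ChartConjugationBounded.consistency_contact₂_of_conj`); 0 def, 0 `def … : Prop`, nothing cited, 0 sorry; 0∕4 row-D1 binders.
NOT the (Kcov) instance: what it still owes is displayed in §3's hypothesis list — the `S∞` part of the gluon contact in (Sr-conj) form (N0b-S (a7)), the SECOND-ORDER
chart shape `CtW = conjW MF … + Rm` of the bi-tables (`sliceCtW` p254164 is explicit; its identification with `conjW` is NOT claimed here), uniform `VertexFamily`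
letters, and the orientation pin N-d1leaf02g9-1 (`MF`'s slice block is the FIBRE-TRANSPOSE of `ddKer`, `SliceGaugeLaw.MF_inl_inl_eq_deltaZLim_add_ddKer`).
NOT H2V-4, NOT D1, NOT BetaPertH, NOT continuum, NOT Clay.

ABSOLUTE RULE (cell charter, verbatim): «No internally-minted statement may enter as a cited fact. Every hypothesis is either kernel-proved in this package or a
verbatim quotation of a PUBLISHED theorem with page reference. The manuscript(s) under audit are NOT citable for their own disputed steps — they are the thing
under adjudication; programme-internal (2001/route/tribunal) claims are never citable.»

CONTENT.
* §1 **`sliceCt_eq_conjV_ddKer : sliceCt 3 α κ′ u = conjV ddKer (diagK (ctGen 3 α L κ′ u))`** (every window parameter `L`; all four fibre blocks) — the `d d*` twin of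
  an2's `WilsonReflectionContact.wilsonCt_inl_inl_eq_conjV` (`wilsonCt = conjV bhK (diagK ctGen)` on the field block); `conjV_diagK_neg`; the law p251422 re-read
  **`sliceA_bref_conj : sliceA 3 κ′ (bref α κ′ u) = reflSign α κ′ • refK (Φ N α) (sliceA 3 κ′ u + conjV ddKer (diagK (−ctGen 3 α L κ′ u)))`** — the (Sr-conj) SHAPE
  of R6 ∕ an2's ENDs with chart inverse `ddKer` and generator `−ctGen`.
* §2 THE FOUR RELATIVE RULES AT THE PERFECT LEG: `spr_MF`, `decays_idF`, `spr_idF`, **`comp_Pker_idF : comp Pker idF = Pker`**, **`comp_idF_Pker : comp idF Pker = Pker`**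
  ((P-INV) supplies the other two: `comp_Pker_MF`, `comp_MF_Pker`), and `comp_idF_diagK_comm` (EVERY diagonal generator commutes with the field-block projector).
* §3 **`consistency_contact₂_perfect`**: R6's `consistency_contact₂_of_conj` AT `(A, M, E) := (Pker, MF, idF)` — for localised vertices `V μ y`, DIAGONAL generators
  `diagK (g μ y)` (localised), localised `X₂`, and a localised remainder `Rm` with `tadpole Pker Rm = 0`, the fifth conjunct of the (Kcov) socket
  `PerfectAsymptoticsBFCov.axisReflectionCovariant_flipK_PiBF_contact₂` holds at `CtVα μ y := conjV MF (diagK (g α μ y))`,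
  `CtWα μ y ν y′ := conjW MF (V μ y) (V ν y′) (diagK (g α μ y)) (diagK (g α ν y′)) (X₂ α μ y ν y′) + Rm α μ y ν y′` — NO inverse∕commutation hypothesis left;
  `loc_diagK_ctGen` records that the product-chart generator qualifies.
Provenance: D1 formalisation swarm seat b2b-balaban-beta-d1-formalise-leaf-02 gen 10 (road FP engine lineage; sub-row H2-ASM-5a (Kcov)), 2026-08-21.
-/

noncomputable section

namespace Summit.QuantumFields.BalabanUV.Beta.FP.SliceContactChart

open Finset
open scoped BigOperators
open Literature.MathematicalPhysics.QuantumFieldTheory.Balaban1983to89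
open Literature.MathematicalPhysics.QuantumFieldTheory.Balaban1983to89.Beta
open B12Sec2to5 (l1 l1_nonneg)
open B5Symbol166Strip (kappa166 kappa166_pos)
open ExpKernelCalculus (MKer Site Decays BiLoc comp tr bubble tadpole)
open KernelWard (Bdd)
open KernelReflection (refK)
open PolarizationSign (reflSign)
open ResolventReflection (bref Φ)
open OneStepResolventKernel (Fib)
open Summit.QuantumFields.BalabanUV.Beta.TameKernelCalculus (Spr Loc)
open Summit.QuantumFields.BalabanUV.Beta.ChartConjugation (conjV conjW)
open Summit.QuantumFields.BalabanUV.Beta.BorderedHessian (diagK diagK_apply ctGen ctGen_inl conjV_diagK_apply biLoc_diagK_ctGen cCT)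
open Summit.QuantumFields.BalabanUV.Beta.FP.SliceVertex (sliceA)
open Summit.QuantumFields.BalabanUV.Beta.FP.SliceVertexReflection (sliceCt sliceCt_inl_inl sliceA_bref)
open Summit.QuantumFields.BalabanUV.Beta.FP.SliceGaugeLaw (ddKer ddKer_inl_inl_eq_dz_codiff₁ ddKer_inl_inr ddKer_inr_inl ddKer_inr_inr)
open Summit.QuantumFields.BalabanUV.Beta.FP.PerfectPolarization (Pker Pker_inl_inr Pker_inr_inl Pker_inr_inr)
open Summit.QuantumFields.BalabanUV.Beta.FP.PerfectPolarizationWard (bdd_Pker)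
open Summit.QuantumFields.BalabanUV.Beta.FP.PerfectPropagatorInverse (MF idF comp_Pker_MF comp_MF_Pker decays_MF)
open Summit.QuantumFields.BalabanUV.Beta.FP.WardSandwichEngine (idM idM_apply comp_idM idM_comp)
open Summit.QuantumFields.BalabanUV.Beta.FP.PerfectPolarizationWardLetters (fmask fmask_inl fmask_inr idF_eq_idM)
open Summit.QuantumFields.BalabanUV.Beta.FP.ChartConjugationBounded (consistency_contact₂_of_conj)

/-! ## §1 The slice's reflection contact is a chart contact against its own `d d*` form -/

/-- [our object] **THE SLICE CONTACT IS A CHART CONTACT**: `sliceCt 3 α κ′ u = conjV ddKer (diagK (ctGen 3 α L κ′ u))` — on the field block both sides are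
`[κ′ = α]·(d d* δ_{(b,z)})_a(x)·([x = u ∧ a = κ′] − [z = u ∧ b = κ′])` (`sliceCt_inl_inl`, `ddKer_inl_inl_eq_dz_codiff₁`, `conjV_diagK_apply`, `ctGen_inl`); every
block touching a multiplier leg vanishes on both sides (`ddKer`'s mixed and multiplier blocks are zero).  Holds for EVERY window parameter `L` (the multiplier
part of `ctGen` never meets `ddKer`). -/
theorem sliceCt_eq_conjV_ddKer (α : Fin 4) (L : ℕ) (κ' : Fin 4) (u : Site 4) :
    sliceCt 3 α κ' u = conjV ddKer (diagK (ctGen 3 α L κ' u)) := by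
  funext x z a b
  rw [conjV_diagK_apply]
  rcases a with a | i <;> rcases b with b | j
  · rw [sliceCt_inl_inl, ddKer_inl_inl_eq_dz_codiff₁, ctGen_inl, ctGen_inl]
    by_cases hk : κ' = α
    · subst hk
      simp only [and_true, if_true, one_mul]
      split_ifs <;> ring
    · simp only [hk, and_false, if_false, sub_self, mul_zero, zero_mul]
  · rw [ddKer_inl_inr, zero_mul]; rfl
  · rw [ddKer_inr_inl, zero_mul]; rfl
  · rw [ddKer_inr_inr, zero_mul]; rfl

/-- [folklore] negating a diagonal generator negates its chart contact: `conjV M (diagK (−g)) = (−1) • conjV M (diagK g)`. -/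
theorem conjV_diagK_neg (M : MKer 4 (Fib 3)) (g : Site 4 → Fib 3 → ℝ) :
    conjV M (diagK (fun x a => -g x a)) = (-1 : ℝ) • conjV M (diagK g) := by
  funext x z a b
  rw [Pi.smul_apply, Pi.smul_apply, Pi.smul_apply, Pi.smul_apply, smul_eq_mul, conjV_diagK_apply, conjV_diagK_apply]
  ring

/-- [our object] **THE REFLECTION LAW OF THE BF SLICE FAMILY IN (Sr-conj) FORM**: `SliceVertexReflection.sliceA_bref` (p251422, constant `−1`) re-read with §1 —
`sliceA 3 κ′ (bref α κ′ u) = reflSign α κ′ • refK (Φ N α) (sliceA 3 κ′ u + conjV ddKer (diagK (−ctGen 3 α L κ′ u)))`: chart inverse `ddKer`, generator the NEGATED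
product-chart generator, for every blocking `N` and window `L`. -/
theorem sliceA_bref_conj (N L : ℕ) (α κ' : Fin 4) (u : Site 4) :
    sliceA 3 κ' (bref α κ' u) = reflSign α κ' • refK (Φ N α) (sliceA 3 κ' u + conjV ddKer (diagK (fun x a => -ctGen 3 α L κ' u x a))) := by
  rw [conjV_diagK_neg, ← sliceCt_eq_conjV_ddKer]
  exact sliceA_bref N α κ' u

/-- [folklore] the product-chart generator is localised at the reflected bond's base point (an2's `biLoc_diagK_ctGen` in `Loc` currency). -/
theorem loc_diagK_ctGen (α : Fin 4) (L : ℕ) [NeZero L] (κ' : Fin 4) (u : Site 4) : Loc (diagK (ctGen 3 α L κ' u)) :=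
  ⟨u, u, cCT 3 L 1, 1, one_pos, biLoc_diagK_ctGen α L κ' u zero_le_one⟩

/-! ## §2 The four relative rules at the perfect leg `(Pker, MF, idF)` -/

/-- [our object] the perfect Feynman form is spread (`PerfectPropagatorInverse.decays_MF`, rate `κ₁₆₆(4)/4 > 0`). -/
theorem spr_MF : Spr MF := by
  obtain ⟨C, _, hC⟩ := decays_MF
  exact ⟨C, kappa166 4 / 4, by have := kappa166_pos 4; positivity, hC⟩

/-- [folklore] the field-block identity decays at every rate (it is supported on the diagonal). -/
theorem decays_idF (δ : ℝ) : Decays (idF : MKer 4 (Fib 3)) 1 δ := by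
  intro x y a b
  rw [idF_eq_idM, idM_apply]
  split_ifs with h
  · rw [h.1, sub_self]
    have : l1 (0 : Site 4) = 0 := by simp [B12Sec2to5.l1]
    rw [this, mul_zero, Real.exp_zero, mul_one]
    rcases a with β | j
    · rw [fmask_inl, abs_one]
    · rw [fmask_inr, abs_zero]; exact zero_le_one
  · rw [abs_zero]; positivity

/-- [our object] the field-block identity is spread. -/
theorem spr_idF : Spr (idF : MKer 4 (Fib 3)) := ⟨1, 1, one_pos, decays_idF 1⟩

/-- [our object] **RULE `A∘E = A` AT THE PERFECT LEG**: `comp Pker idF = Pker` (`Pker` vanishes on every block touching a multiplier leg). -/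
theorem comp_Pker_idF : comp Pker idF = Pker := by
  funext x z a b
  rw [idF_eq_idM, comp_idM]
  rcases b with β | j
  · rw [fmask_inl, mul_one]
  · rcases a with α | i
    · rw [Pker_inl_inr, zero_mul]
    · rw [Pker_inr_inr, zero_mul]

/-- [our object] **RULE `E∘A = A` AT THE PERFECT LEG**: `comp idF Pker = Pker`. -/
theorem comp_idF_Pker : comp idF Pker = Pker := by
  funext x z a b
  rw [idF_eq_idM, idM_comp]
  rcases a with α | i
  · rw [fmask_inl, one_mul]
  · rcases b with β | j
    · rw [Pker_inr_inl, mul_zero]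
    · rw [Pker_inr_inr, mul_zero]

/-- [folklore] **EVERY DIAGONAL GENERATOR COMMUTES WITH THE FIELD-BLOCK PROJECTOR**: `comp idF (diagK g) = comp (diagK g) idF`. -/
theorem comp_idF_diagK_comm (g : Site 4 → Fib 3 → ℝ) : comp idF (diagK g) = comp (diagK g) idF := by
  funext x z a b
  rw [idF_eq_idM, idM_comp, comp_idM, diagK_apply]
  split_ifs with h
  · rw [h.2]; ring
  · ring

/-! ## §3 R6's consistency identity at the perfect leg, for every diagonal generator family -/

/-- [our object] **THE (Kcov) SOCKET'S CONSISTENCY IDENTITY AT THE PERFECT LEG, DIAGONAL GENERATORS** — R6 `consistency_contact₂_of_conj` at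
`(A, M, E) := (Pker, MF, idF)` with the four rules DISCHARGED (`comp_Pker_MF`, `comp_MF_Pker` = (P-INV) ✓; `comp_Pker_idF`, `comp_idF_Pker` §2) and the commutation
DISCHARGED for diagonal generators (`comp_idF_diagK_comm`).  What remains displayed: localisation of the vertices `V μ y`, of the generators `diagK (g μ y)`
(`loc_diagK_ctGen` for the product chart), of `X₂` and of the remainder `Rm`, and `tadpole Pker Rm = 0`.  The conclusion is the fifth conjunct of
`PerfectAsymptoticsBFCov.axisReflectionCovariant_flipK_PiBF_contact₂` BY TYPE at `CtVα μ y := conjV MF (diagK (g μ y))`,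
`CtWα μ y ν y′ := conjW MF (V μ y) (V ν y′) (diagK (g μ y)) (diagK (g ν y′)) (X₂ μ y ν y′) + Rm μ y ν y′`. -/
theorem consistency_contact₂_perfect {V : Fin 4 → Site 4 → MKer 4 (Fib 3)} {g : Fin 4 → Site 4 → (Site 4 → Fib 3 → ℝ)}
    {X₂ Rm : Fin 4 → Site 4 → Fin 4 → Site 4 → MKer 4 (Fib 3)} (hV : ∀ μ y, Loc (V μ y)) (hg : ∀ μ y, Loc (diagK (g μ y)))
    (hX₂ : ∀ μ y ν y', Loc (X₂ μ y ν y')) (hRmL : ∀ μ y ν y', Loc (Rm μ y ν y')) (hRm0 : ∀ μ y ν y', tadpole Pker (Rm μ y ν y') = 0) :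
    ∀ (μ ν : Fin 4) (z : Site 4),
      tadpole Pker (conjW MF (V μ 0) (V ν z) (diagK (g μ 0)) (diagK (g ν z)) (X₂ μ 0 ν z) + Rm μ 0 ν z) =
        bubble Pker (conjV MF (diagK (g μ 0))) (V ν z) + bubble Pker (V μ 0) (conjV MF (diagK (g ν z))) +
          bubble Pker (conjV MF (diagK (g μ 0))) (conjV MF (diagK (g ν z))) :=
  consistency_contact₂_of_conj (X := fun μ y => diagK (g μ y)) bdd_Pker spr_MF spr_idF comp_Pker_MF comp_MF_Pker comp_Pker_idF comp_idF_Pker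
    hV hg hX₂ (fun μ y => comp_idF_diagK_comm (g μ y)) hRmL hRm0

end Summit.QuantumFields.BalabanUV.Beta.FP.SliceContactChart

end
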